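import Summits.CriticalPhenomena.PercolationContinuityZ3.Theorems.Transplant.BccClawXTable
import HarnessLib

/-!
# The bcc (001)-slabs, exit-form routing certificate IID: the planar claw rule `clawX` SUCCEEDS — clip classes `(3, 3, 0, 2)`, `(3, 3, 0, 3)`, `(3, 3, 1, 3)`, `(3, 3, 2, 2)`, `(3, 3, 2, 3)`, `(3, 4, 0, 4)`, `(3, 4, 2, 3)`, `(3, 4, 2, 4)` (kernel computation)

builds on p205010 (kernel theorem, internal audit signed; external expert review pending) — NOT used in this file.
Lane `prim-bschramm`, seat `prim-bschramm-p2` (gen 46; class C1b, METHOD = input substitution; memo `HOME/bschramm/P2-LATTICES.md` §156); helper file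
(`--supports stmt-CriticalPhenomena-4575 --as helper`).  One `decide +kernel` theorem per clip class `(t_R, t_D, s_R, s_D)` with `t_R = 3` of
«BccClawXTable».`ClawXOK` (standard axioms, no `native_decide`); the classes with `t_R < 3` (hence `s_R = 3`) follow by the diagonal mirror in
«BccClawXSound».  The four files «BccClawXTableOK{A,B,C,D}» together cover the `28` classes `t_D ∈ {3, 4}`, `s_R ≤ s_D ≤ 4`, `s_R ≤ 3`
(`62 924` admissible configurations).
[cite: DuminilCopinSidoraviciusTassion2016, §2.3 (proof of Fact 2: the three disjoint paths in B̄_R(z))]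
-/

namespace Summit.CriticalPhenomena.PercolationContinuityZ3.Theorems.Transplant

namespace BccClawX

/-- Clip class `(t_R, t_D, s_R, s_D) = (3, 3, 0, 2)`. [folklore] -/
theorem clawXOK_3302 : ClawXOK 3 3 0 2 := by unfold ClawXOK; decide +kernel

/-- Clip class `(t_R, t_D, s_R, s_D) = (3, 3, 0, 3)`. [folklore] -/
theorem clawXOK_3303 : ClawXOK 3 3 0 3 := by unfold ClawXOK; decide +kernel

/-- Clip class `(t_R, t_D, s_R, s_D) = (3, 3, 1, 3)`. [folklore] -/
theorem clawXOK_3313 : ClawXOK 3 3 1 3 := by unfold ClawXOK; decide +kernel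

/-- Clip class `(t_R, t_D, s_R, s_D) = (3, 3, 2, 2)`. [folklore] -/
theorem clawXOK_3322 : ClawXOK 3 3 2 2 := by unfold ClawXOK; decide +kernel

/-- Clip class `(t_R, t_D, s_R, s_D) = (3, 3, 2, 3)`. [folklore] -/
theorem clawXOK_3323 : ClawXOK 3 3 2 3 := by unfold ClawXOK; decide +kernel

/-- Clip class `(t_R, t_D, s_R, s_D) = (3, 4, 0, 4)`. [folklore] -/
theorem clawXOK_3404 : ClawXOK 3 4 0 4 := by unfold ClawXOK; decide +kernel

/-- Clip class `(t_R, t_D, s_R, s_D) = (3, 4, 2, 3)`. [folklore] -/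
theorem clawXOK_3423 : ClawXOK 3 4 2 3 := by unfold ClawXOK; decide +kernel

/-- Clip class `(t_R, t_D, s_R, s_D) = (3, 4, 2, 4)`. [folklore] -/
theorem clawXOK_3424 : ClawXOK 3 4 2 4 := by unfold ClawXOK; decide +kernel

end BccClawX

end Summit.CriticalPhenomena.PercolationContinuityZ3.Theorems.Transplant
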